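import Summits.Schanuel.Schanuel.Theorems.ZilberEacFibreAlgebra
import Summits.Schanuel.Schanuel.Theorems.ZilberEacFibreTrdeg
import Summits.Schanuel.Schanuel.Theorems.ZilberEacFibreCoords
import Summits.Schanuel.Schanuel.Theorems.ZilberEacFibreGeneric
import HarnessLib

/-!
# The fibration principle: varieties fibred in curves over a variety with dense exponential points

Zilber's Exponential-Algebraic Closedness, case ladder (host summit Schanuel, cell `pub-schanuel`,
seat 2, gen 5).  The first result of this packet that USES the dimension of a projection (the
quantity rotundity controls) rather than an explicit fibre shape.

**Theorem F** (`inter_expGraph_nonempty_of_unprojectedDense`).  Let `W ⊆ ℂ^{d+1} × ℂ^{d+1}` be an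
irreducible Zariski closed set of dimension `d + 1` meeting the torus `Gⁿ`, and let
`V' = cl [Δ_d](W ∩ Gⁿ)` be the closure of its image under "forget `x_last`, `y_last`"
(`Δ_d = dropLastMat d`; `V'` lives in `{x_last = 0, y_last = 1}`).  Suppose
`dim V' = d` (so the generic fibres of `W → V'` are CURVES in `ℂ_{x_last} × ℂ_{y_last}`) and the
exponential points of `V'` are Zariski dense in `V'` (`UnprojectedDense V'`).  Then `W` meets the graph
of exponentiation.  No rotundity, freeness or period hypothesis is needed.

Proof.  At the generic point `ξ` of `W` (function field `K`, `trdeg_ℂ K = d + 1`) the small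
coordinates `s̄` have transcendence rank `d` (`ZilberEacFibreGeneric`), so one of `x_last, y_last` is
transcendental over `ℂ(s̄)` and the other algebraic over it and the first (`ZilberEacFibreTrdeg`).  The
pseudo-division fibre lemma (`ZilberEacFibreAlgebra.fibre_core`) then gives a small polynomial `c ∉ P₁`
such that over every point `p ∈ Z(P₁) = V'` with `c(p) ≠ 0`, all but finitely many values `u₀` of the
transcendental coordinate extend to a point `(p, u₀, v₀) ∈ W` (with `v₀ ≠ 0` when `v = y_last`).
Density supplies such a `p` which is an exponential point.  If `x_last` is the transcendental one, the
fibre `W_p ⊆ ℂ × ℂ` is Zariski closed with dominant `x`-projection on the torus, and the tree theorem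
`aslanyanKirbyMantova2023_thm_1_5_holds` (`n = 1`) gives `(a, e^a) ∈ W_p`; if `y_last` is, either the
same applies or infinitely many `y`-values share one `x`-value `a₀`, and then the whole line
`{a₀} × ℂ ⊆ W_p` contains `(a₀, e^{a₀})`.

**Corollary** (`ecCellPeriodicStdFib_of_unprojectedDense`).  The FIBRED piece
`ECCellPeriodicStdFib d` of the periodic half of the cell `EC(d+1, d)` (seat 1,
`EACPeriodicReduction`) follows from the Zariski density of exponential points on the projected
`d`-folds — for `d = 2` this is Mantova–Masser's question (PLMS 2024, §1 "Further remarks") for the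
`(2,1)`-surfaces `V'`; the converse direction (a `y_last`-cylinder over `V'` punctured along a curve)
shows the two are genuinely tied.

HONEST FRAMING: a REDUCTION of one of the three typed open pieces of `EC(3,2)` to a density
question raised in print, plus unconditional members wherever that density is decided (seat 1's
`EACDensityQuestion` / `EACDensityFamilies`); `EC(3,2)` itself remains OPEN; nothing here bears on
Schanuel's conjecture (EAC does not imply SC).
-/

noncomputable section

open MvPolynomial
open Literature.NumberTheory.Transcendental Literature.ModelTheory.Zilber
open Literature.ModelTheory.ExponentialFields

set_option linter.dupNamespace false

namespace Summit.Schanuel.Schanuel.Theorems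

variable {d : ℕ}

/-! ## Endgames on the fibre `W_p ⊆ ℂ × ℂ` -/

section Endgame

variable (P : Ideal (MvPolynomial (Fin (d + 1) ⊕ Fin (d + 1)) ℂ))

/-- A glued point over an exponential small point is exponential iff its last coordinates are.
[folklore] -/
theorem glue_mem_expGraph {p : Fin d ⊕ Fin d → ℂ}
    (hp : ∀ i, p (Sum.inr i) = ExponentialRing.exp (p (Sum.inl i))) {a b : ℂ}
    (hab : b = ExponentialRing.exp a) :
    (Sum.elim (Fin.snoc (fun i => p (Sum.inl i)) a) (Fin.snoc (fun i => p (Sum.inr i)) b) :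
      Fin (d + 1) ⊕ Fin (d + 1) → ℂ) ∈ expGraph ℂ (d + 1) := by
  rw [mem_expGraph_iff]
  intro k
  rcases Fin.eq_castSucc_or_eq_last k with ⟨i, rfl⟩ | rfl
  · simp only [Sum.elim_inr, Sum.elim_inl, Fin.snoc_castSucc]
    exact hp i
  · simp only [Sum.elim_inr, Sum.elim_inl, Fin.snoc_last]
    exact hab

/-- **Endgame 1.**  If over the exponential small point `p` all but finitely many values `a` of
`x_last` carry a point `(p, a, b) ∈ Z(P)` with `b ≠ 0`, then `Z(P)` meets `Γ_exp`: the fibre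
`W_p ⊆ ℂ × ℂ` is Zariski closed with dominant additive projection on the torus, so
Aslanyan–Kirby–Mantova Thm 1.5 (`n = 1`, tree theorem) applies. [cite: AslanyanKirbyMantova2021, Thm 1.5] -/
theorem exists_expPoint_of_cofinite_fst {p : Fin d ⊕ Fin d → ℂ}
    (hp : ∀ i, p (Sum.inr i) = ExponentialRing.exp (p (Sum.inl i)))
    (hfin : Set.Finite {a : ℂ | ¬ ∃ b : ℂ, b ≠ 0 ∧
      (Sum.elim (Fin.snoc (fun i => p (Sum.inl i)) a) (Fin.snoc (fun i => p (Sum.inr i)) b) :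
        Fin (d + 1) ⊕ Fin (d + 1) → ℂ) ∈ zeroLocus ℂ P}) :
    (zeroLocus ℂ P ∩ expGraph ℂ (d + 1)).Nonempty := by
  haveI : Infinite ℂ := Infinite.of_injective _ Nat.cast_injective
  set Wp : Set (Fin 1 ⊕ Fin 1 → ℂ) := {w |
    (Sum.elim (Fin.snoc (fun i => p (Sum.inl i)) (w (Sum.inl 0)))
      (Fin.snoc (fun i => p (Sum.inr i)) (w (Sum.inr 0))) : Fin (d + 1) ⊕ Fin (d + 1) → ℂ) ∈
        zeroLocus ℂ P} with hWp
  have hclosed : IsZariskiClosed ℂ Wp := isZariskiClosed_fibre P p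
  have hinf : Set.Infinite {t : ℂ | ∃ w ∈ Wp ∩ torusLocus ℂ 1, w (Sum.inl 0) = t} := by
    refine hfin.infinite_compl.mono ?_
    intro a ha
    simp only [Set.mem_compl_iff, Set.mem_setOf_eq, not_not] at ha
    obtain ⟨b, hb0, hb⟩ := ha
    refine ⟨Sum.elim (fun _ => a) (fun _ => b), ⟨?_, fun _ => ?_⟩, rfl⟩
    · simpa only [hWp, Set.mem_setOf_eq, Sum.elim_inl, Sum.elim_inr] using hb
    · simpa only [Sum.elim_inr] using hb0
  obtain ⟨w, hwW, hwΓ⟩ :=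
    aslanyanKirbyMantova2023_thm_1_5_holds 1 Wp hclosed (hasDominantAddProjection_of_infinite_fst hinf)
  exact ⟨_, hwW, glue_mem_expGraph hp ((mem_expGraph_iff.1 hwΓ) 0)⟩

/-- **Endgame 2.**  If over the exponential small point `p` all but finitely many values `b` of
`y_last` carry a point `(p, a, b) ∈ Z(P)`, then `Z(P)` meets `Γ_exp`: either the fibre has infinitely
many `x`-values on the torus (Endgame 1's mechanism), or infinitely many `b` share one `a₀`, and then
every polynomial of `P` vanishes on the line `(p, a₀, ·)`, in particular at `(p, a₀, e^{a₀})`.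
[cite: AslanyanKirbyMantova2021, Thm 1.5] -/
theorem exists_expPoint_of_cofinite_snd {p : Fin d ⊕ Fin d → ℂ}
    (hp : ∀ i, p (Sum.inr i) = ExponentialRing.exp (p (Sum.inl i)))
    (hfin : Set.Finite {b : ℂ | ¬ ∃ a : ℂ,
      (Sum.elim (Fin.snoc (fun i => p (Sum.inl i)) a) (Fin.snoc (fun i => p (Sum.inr i)) b) :
        Fin (d + 1) ⊕ Fin (d + 1) → ℂ) ∈ zeroLocus ℂ P}) :
    (zeroLocus ℂ P ∩ expGraph ℂ (d + 1)).Nonempty := by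
  classical
  haveI : Infinite ℂ := Infinite.of_injective _ Nat.cast_injective
  set Wp : Set (Fin 1 ⊕ Fin 1 → ℂ) := {w |
    (Sum.elim (Fin.snoc (fun i => p (Sum.inl i)) (w (Sum.inl 0)))
      (Fin.snoc (fun i => p (Sum.inr i)) (w (Sum.inr 0))) : Fin (d + 1) ⊕ Fin (d + 1) → ℂ) ∈
        zeroLocus ℂ P} with hWp
  have hclosed : IsZariskiClosed ℂ Wp := isZariskiClosed_fibre P p
  by_cases hA : Set.Infinite {t : ℂ | ∃ w ∈ Wp ∩ torusLocus ℂ 1, w (Sum.inl 0) = t}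
  · obtain ⟨w, hwW, hwΓ⟩ :=
      aslanyanKirbyMantova2023_thm_1_5_holds 1 Wp hclosed (hasDominantAddProjection_of_infinite_fst hA)
    exact ⟨_, hwW, glue_mem_expGraph hp ((mem_expGraph_iff.1 hwΓ) 0)⟩
  · rw [Set.not_infinite] at hA
    -- the good `y_last`-values
    set GOOD : Set ℂ := {b : ℂ | b ≠ 0 ∧ ∃ a : ℂ,
      (Sum.elim (Fin.snoc (fun i => p (Sum.inl i)) a) (Fin.snoc (fun i => p (Sum.inr i)) b) :
        Fin (d + 1) ⊕ Fin (d + 1) → ℂ) ∈ zeroLocus ℂ P} with hGOOD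
    have hGinf : GOOD.Infinite := by
      refine (hfin.insert 0).infinite_compl.mono ?_
      intro b hb
      simp only [Set.mem_compl_iff, Set.mem_insert_iff, Set.mem_setOf_eq, not_or, not_not] at hb
      exact ⟨hb.1, hb.2⟩
    -- each good value has an `x`-value in the finite set of `x`-values
    set AV : Set ℂ := {t : ℂ | ∃ w ∈ Wp ∩ torusLocus ℂ 1, w (Sum.inl 0) = t} with hAV
    have hch : ∀ b : GOOD, ∃ a : AV,
        (Sum.elim (Fin.snoc (fun i => p (Sum.inl i)) (a : ℂ)) (Fin.snoc (fun i => p (Sum.inr i)) (b : ℂ)) :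
          Fin (d + 1) ⊕ Fin (d + 1) → ℂ) ∈ zeroLocus ℂ P := by
      rintro ⟨b, hb0, a, ha⟩
      refine ⟨⟨a, Sum.elim (fun _ => a) (fun _ => b), ⟨?_, fun _ => ?_⟩, rfl⟩, ha⟩
      · simpa only [hWp, Set.mem_setOf_eq, Sum.elim_inl, Sum.elim_inr] using ha
      · simpa only [Sum.elim_inr] using hb0
    choose f hf using hch
    haveI : Infinite GOOD := hGinf.to_subtype
    haveI : Finite AV := hA.to_subtype
    obtain ⟨⟨a₀, ha₀⟩, hfib⟩ := Finite.exists_infinite_fiber f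
    -- infinitely many `b` with `(p, a₀, b) ∈ Z(P)`
    have hroots : Set.Infinite {b : ℂ |
        (Sum.elim (Fin.snoc (fun i => p (Sum.inl i)) a₀) (Fin.snoc (fun i => p (Sum.inr i)) b) :
          Fin (d + 1) ⊕ Fin (d + 1) → ℂ) ∈ zeroLocus ℂ P} := by
      have hpre : (f ⁻¹' {⟨a₀, ha₀⟩} : Set GOOD).Infinite := Set.infinite_coe_iff.1 hfib
      refine (hpre.image Subtype.val_injective.injOn).mono ?_
      rintro _ ⟨b, hb, rfl⟩
      have := hf b
      rw [Set.mem_preimage, Set.mem_singleton_iff] at hb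
      rw [hb] at this
      exact this
    -- every `H ∈ P` vanishes along the line `(p, a₀, ·)`, in particular at `e^{a₀}`
    refine ⟨_, ?_, glue_mem_expGraph hp (rfl : ExponentialRing.exp a₀ = ExponentialRing.exp a₀)⟩
    rw [mem_zeroLocus_iff]
    intro H hH
    set q : Polynomial ℂ :=
      ((MvPolynomial.aeval (R := ℂ)
        (Sum.elim (Fin.snoc (fun i => Polynomial.C (Polynomial.C (X (Sum.inl i)))) (Polynomial.C Polynomial.X))
          (Fin.snoc (fun i => Polynomial.C (Polynomial.C (X (Sum.inr i)))) Polynomial.X) :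
          Fin (d + 1) ⊕ Fin (d + 1) → Polynomial (Polynomial (MvPolynomial (Fin d ⊕ Fin d) ℂ))) H).map
        (Polynomial.eval₂RingHom (MvPolynomial.aeval (R := ℂ) p : MvPolynomial (Fin d ⊕ Fin d) ℂ →+* ℂ) a₀))
      with hq
    have hqt : ∀ t : ℂ, q.eval t = MvPolynomial.aeval
        (Sum.elim (Fin.snoc (fun i => p (Sum.inl i)) a₀) (Fin.snoc (fun i => p (Sum.inr i)) t) :
          Fin (d + 1) ⊕ Fin (d + 1) → ℂ) H := by
      intro t
      rw [hq, Polynomial.eval_map, ← Polynomial.coe_eval₂RingHom]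
      exact aeval_fibreLift₁ p a₀ t H
    have hq0 : q = 0 := by
      refine Polynomial.eq_zero_of_infinite_isRoot q (hroots.mono fun t ht => ?_)
      simp only [Set.mem_setOf_eq] at ht ⊢
      rw [Polynomial.IsRoot.def, hqt]
      exact (mem_zeroLocus_iff.1 ht) H hH
    have := hqt (ExponentialRing.exp a₀)
    rw [hq0, Polynomial.eval_zero] at this
    exact this.symm

end Endgame

/-! ## Theorem F -/

section Main

/-- **Theorem F (fibration principle), ideal form.**  For a prime `P ⊆ ℂ[X_σ]` with `Z(P)` meeting the
torus, `dim Z(P) = d + 1`, `dim cl[Δ_d](Z(P) ∩ Gⁿ) = d` and the exponential points of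
`cl[Δ_d](Z(P) ∩ Gⁿ)` Zariski dense, `Z(P)` meets `Γ_exp`. [cite: MantovaMasser2023, §1 Further remarks] -/
theorem zeroLocus_inter_expGraph_nonempty_of_unprojectedDense
    (P : Ideal (MvPolynomial (Fin (d + 1) ⊕ Fin (d + 1)) ℂ)) [P.IsPrime]
    (hne : (zeroLocus ℂ P ∩ torusLocus ℂ (d + 1)).Nonempty)
    (hdim : zariskiDim ℂ (zeroLocus ℂ P) = (d + 1 : ℕ))
    (hfib : zariskiDim ℂ (matrixAct (dropLastMat d) '' (zeroLocus ℂ P ∩ torusLocus ℂ (d + 1))) = d)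
    (hdense : UnprojectedDense (zeroLocus ℂ (vanishingIdeal ℂ
      (matrixAct (dropLastMat d) '' (zeroLocus ℂ P ∩ torusLocus ℂ (d + 1)))))) :
    (zeroLocus ℂ P ∩ expGraph ℂ (d + 1)).Nonempty := by
  classical
  -- the generic point and its small coordinates
  set ξ : Fin (d + 1) ⊕ Fin (d + 1) → zeroLocusFunctionField P := genericPt P with hξ
  set sbar : Fin d ⊕ Fin d → zeroLocusFunctionField P :=
    fun t => ξ (Sum.map Fin.castSucc Fin.castSucc t) with hsbar
  -- rank data of the small coordinates
  obtain ⟨b, hb, hbmem⟩ := exists_algebraicIndependent_small P hne hfib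
  choose c hc using hbmem
  have hbS : Set.range b ⊆ Set.range sbar := by
    rintro _ ⟨k, rfl⟩
    exact ⟨c k, (hc k).symm⟩
  have halg : ∀ a ∈ Set.range sbar, IsAlgebraic (Algebra.adjoin ℂ (Set.range b)) a := by
    refine isAlgebraic_of_maximal hb fun a ha hind => ?_
    obtain ⟨t₀, rfl⟩ := ha
    have hind' : AlgebraicIndependent ℂ fun o : Option (Fin d) =>
        genericPt P (Sum.map Fin.castSucc Fin.castSucc (o.elim t₀ c)) := by
      refine (algebraicIndependent_equiv' (Equiv.refl _) ?_).1 hind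
      funext o
      rcases o with _ | k
      · rfl
      · simp only [Function.comp_apply, Equiv.coe_refl, id_eq, Option.elim_some]
        exact (hc k).symm
    have hle := card_le_of_algebraicIndependent_small P hne hfib _ hind'
    rw [Fintype.card_option, Fintype.card_fin] at hle
    omega
  have hcard := trdeg_functionField_eq P hdim
  -- `K` is algebraic over `ℂ[s̄, x_last, y_last]`
  have hsub : Set.range (genericPt P) ⊆ insert (ξ (Sum.inl (Fin.last d)))
      (insert (ξ (Sum.inr (Fin.last d))) (Set.range sbar)) := by
    rintro _ ⟨j, rfl⟩
    rcases j with k | k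
    · rcases Fin.eq_castSucc_or_eq_last k with ⟨i, rfl⟩ | rfl
      · exact Or.inr (Or.inr ⟨Sum.inl i, rfl⟩)
      · exact Or.inl rfl
    · rcases Fin.eq_castSucc_or_eq_last k with ⟨i, rfl⟩ | rfl
      · exact Or.inr (Or.inr ⟨Sum.inr i, rfl⟩)
      · exact Or.inr (Or.inl rfl)
  have hK : Algebra.IsAlgebraic (Algebra.adjoin ℂ (insert (ξ (Sum.inl (Fin.last d)))
      (insert (ξ (Sum.inr (Fin.last d))) (Set.range sbar)))) (zeroLocusFunctionField P) :=
    ⟨fun x => ((isAlgebraic_functionField_adjoin P).isAlgebraic x).tower_top_of_subalgebra_le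
      (Algebra.adjoin_mono hsub)⟩
  -- `y_last ≠ 0` at the generic point
  have hY : ξ (Sum.inr (Fin.last d)) ≠ 0 :=
    (genericPt_mem_torusLocus P (X_inr_notMem_of_nonempty P hne)) (Fin.last d)
  -- evaluating a polynomial of `P` at the glued generic point gives `0`
  have hglue : (Sum.elim (Fin.snoc (fun i => sbar (Sum.inl i)) (ξ (Sum.inl (Fin.last d))))
      (Fin.snoc (fun i => sbar (Sum.inr i)) (ξ (Sum.inr (Fin.last d)))) :
        Fin (d + 1) ⊕ Fin (d + 1) → zeroLocusFunctionField P) = ξ :=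
    glue_restrict_self ξ
  have hP : ∀ H ∈ P, MvPolynomial.aeval
      (Sum.elim (Fin.snoc (fun i => sbar (Sum.inl i)) (ξ (Sum.inl (Fin.last d))))
        (Fin.snoc (fun i => sbar (Sum.inr i)) (ξ (Sum.inr (Fin.last d)))) :
          Fin (d + 1) ⊕ Fin (d + 1) → zeroLocusFunctionField P) H = 0 := by
    intro H hH
    rw [hglue]
    exact (isGenericPt_genericPt P H).2 hH
  rcases transcendental_or_transcendental halg (ξ (Sum.inl (Fin.last d)))
      (ξ (Sum.inr (Fin.last d))) hK hcard with hu | hu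
  · -- Case 1: `x_last` transcendental over `ℂ(s̄)`, `y_last` algebraic over `ℂ(s̄, x_last)`
    have hv := isAlgebraic_insert_of_transcendental (v := ξ (Sum.inr (Fin.last d))) hb hbS hu hcard
    obtain ⟨c₀, hc₀, hmain⟩ := fibre_core (F := ℂ)
      (fun h hh i => coeff_eval_eq_zero_of_transcendental sbar hu h hh i)
      (exists_relation_of_isAlgebraic sbar hv) hY
    obtain ⟨p, hpexp, hpZ, hpc⟩ := exists_expPoint_small_of_unprojectedDense P hne hdense c₀ hc₀
    have hfinite := hmain (MvPolynomial.aeval (R := ℂ) p : MvPolynomial (Fin d ⊕ Fin d) ℂ →+* ℂ)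
      (fun a ha => hpZ a ha) hpc
    refine exists_expPoint_of_cofinite_fst P hpexp (hfinite.subset ?_)
    intro u₀ hu₀
    simp only [Set.mem_setOf_eq] at hu₀ ⊢
    rintro ⟨v₀, hv₀, hH⟩
    apply hu₀
    refine ⟨v₀, hv₀, ?_⟩
    rw [mem_zeroLocus_iff]
    intro H' hH'
    have h1 := hH _ (by rw [aeval_fibreLift₁]; exact hP H' hH')
    rw [Polynomial.eval_map, ← Polynomial.coe_eval₂RingHom, aeval_fibreLift₁] at h1
    exact h1
  · -- Case 2: `y_last` transcendental over `ℂ(s̄)`, `x_last` algebraic over `ℂ(s̄, y_last)`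
    have hv := isAlgebraic_insert_of_transcendental (v := ξ (Sum.inl (Fin.last d))) hb hbS hu hcard
    obtain ⟨c₀, hc₀, hmain⟩ := fibre_core' (F := ℂ)
      (fun h hh i => coeff_eval_eq_zero_of_transcendental sbar hu h hh i)
      (exists_relation_of_isAlgebraic sbar hv)
    obtain ⟨p, hpexp, hpZ, hpc⟩ := exists_expPoint_small_of_unprojectedDense P hne hdense c₀ hc₀
    have hfinite := hmain (MvPolynomial.aeval (R := ℂ) p : MvPolynomial (Fin d ⊕ Fin d) ℂ →+* ℂ)
      (fun a ha => hpZ a ha) hpc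
    refine exists_expPoint_of_cofinite_snd P hpexp (hfinite.subset ?_)
    intro u₀ hu₀
    simp only [Set.mem_setOf_eq] at hu₀ ⊢
    rintro ⟨v₀, hH⟩
    apply hu₀
    refine ⟨v₀, ?_⟩
    rw [mem_zeroLocus_iff]
    intro H' hH'
    have h1 := hH _ (by rw [aeval_fibreLift₂]; exact hP H' hH')
    rw [Polynomial.eval_map, ← Polynomial.coe_eval₂RingHom, aeval_fibreLift₂] at h1
    exact h1

/-- **Theorem F (fibration principle).**  Let `W ⊆ ℂ^{d+1} × ℂ^{d+1}` be irreducible Zariski closed,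
meeting the torus, of dimension `d + 1`, with `dim cl[Δ_d](W ∩ Gⁿ) = d` (generic fibres of
`W → cl[Δ_d] W` are curves in `ℂ_{x_last} × ℂ_{y_last}`).  If the exponential points of the projected
variety `cl[Δ_d](W ∩ Gⁿ)` are Zariski dense in it (`UnprojectedDense`), then `W ∩ Γ_exp ≠ ∅`.
No rotundity, freeness or period hypothesis. [cite: MantovaMasser2023, §1 Further remarks] -/
theorem inter_expGraph_nonempty_of_unprojectedDense {W : Set (Fin (d + 1) ⊕ Fin (d + 1) → ℂ)}
    (hW : IsIrreducibleClosed ℂ W) (hne : (W ∩ torusLocus ℂ (d + 1)).Nonempty)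
    (hdim : zariskiDim ℂ W = (d + 1 : ℕ))
    (hfib : zariskiDim ℂ (matrixAct (dropLastMat d) '' (W ∩ torusLocus ℂ (d + 1))) = d)
    (hdense : UnprojectedDense (zeroLocus ℂ (vanishingIdeal ℂ
      (matrixAct (dropLastMat d) '' (W ∩ torusLocus ℂ (d + 1)))))) :
    (W ∩ expGraph ℂ (d + 1)).Nonempty := by
  have hWP : W = zeroLocus ℂ (vanishingIdeal ℂ W) := eq_zeroLocus_vanishingIdeal_of_isZariskiClosed hW.1
  haveI : (vanishingIdeal ℂ W).IsPrime := hW.2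
  rw [hWP] at hne hdim hfib hdense ⊢
  exact zeroLocus_inter_expGraph_nonempty_of_unprojectedDense (vanishingIdeal ℂ W) hne hdim hfib hdense

/-- **Corollary: the fibred periodic piece follows from density.**  If for every irreducible
`(d+1)`-fold `W` meeting the torus with `dim cl[Δ_d](W ∩ Gⁿ) = d` the exponential points of
`cl[Δ_d](W ∩ Gⁿ)` are Zariski dense, then `ECCellPeriodicStdFib d` holds (its rotundity, freeness,
period and base-dimension binders are not even used).  For `d = 2` the hypothesis is Mantova–Masser's
density question for the projected `(2,1)`-surfaces. [cite: MantovaMasser2023, §1 Further remarks] -/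
theorem ecCellPeriodicStdFib_of_unprojectedDense (d : ℕ)
    (hdens : ∀ W : Set (Fin (d + 1) ⊕ Fin (d + 1) → ℂ), IsIrreducibleClosed ℂ W →
      (W ∩ torusLocus ℂ (d + 1)).Nonempty → zariskiDim ℂ W = (d + 1 : ℕ) →
      zariskiDim ℂ (matrixAct (dropLastMat d) '' (W ∩ torusLocus ℂ (d + 1))) = d →
      UnprojectedDense (zeroLocus ℂ (vanishingIdeal ℂ
        (matrixAct (dropLastMat d) '' (W ∩ torusLocus ℂ (d + 1)))))) :
    ECCellPeriodicStdFib d := by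
  intro W hW hne _ _ _ hdim _ _ hfib
  exact inter_expGraph_nonempty_of_unprojectedDense hW hne hdim hfib (hdens W hW hne hdim hfib)

end Main

end Summit.Schanuel.Schanuel.Theorems
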